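import Literature.IUT.LogVolume.HullCaseModel
import Literature.IUT.LogVolume.PrimeResidueVolumes
import HarnessLib

/-!
# [IUTchIII] Remark 3.9.5 (iv) (Ξ1^non) in the model: when is `Ξ(P) ≠ ∅`?

Mochizuki, [IUTchIII] Rmk. 3.9.5 (iv) (Ξ1), kurims p. 128 (read on the page, own render): "(Ξ1) If
either of the following conditions is satisfied, then it is easily verified that `Ξ(P) ≠ ∅`:
(Ξ1^non) if we write `K^cl` for the Galois closure of `K` over `ℚ`, then the residue field extension
degree of each valuation `∈ 𝕍(K^cl)` that divides `v_ℚ ∈ 𝕍_ℚ^non` is `= 1`, and, moreover,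
`μ^log(P) = μ^log(Q)`, for some `Q ∈ Preg` which is a `ℤ_{p_{v_ℚ}}`-submodule of `𝓘^ℚ((−))`; (Ξ1^arc)
`v_ℚ ∈ 𝕍_ℚ^arc`."  Here `Ξ(P) := {H ∈ Hul | φ(P) ⊇ H, μ^log(H) = μ^log(P)}` (Rmk. 3.9.5 (iii), p. 128).

The layer-L6 file `Literature/IUT/LogThetaLattice/HolomorphicHull.lean` (abc-iut-L6-t4) types (Ξ1) as
the NAMED statement `LogThetaLattice.Xi1_nonempty Hul φ μlog ResidueDegreesOne IsArchimedean
IsSubmoduleRegion Preg` over abstract data; the model files `HullModel.lean` / `HullCaseModel.lean` /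
`Xi3Model.lean` (abc-iut-S2) construct `Hul = hullSets K`, `φ = holomorphicHull K`, `Preg =
directProductRegions K` and the weighted log-volume `boxLogVolume K w` for a finite family `K_j` of
nonarchimedean local fields, and mark "(Ξ1)" as deliberately NOT treated there.  This file treats the
NONARCHIMEDEAN clause (Ξ1^non) in that model (`IsArchimedean := False`), with
`ResidueDegreesOne := ∃ p prime, ∀ j, #(O_{K_j}/m_{K_j}) = p` (all residue fields are the SAME prime
field) and `IsSubmoduleRegion Q :=` "`Q` is (the carrier of) an additive subgroup" — WEAKER than the
printed "`ℤ_p`-submodule", so the theorems below are stronger than the printed clause asks: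

* `lt_xi1_nonempty_const` — **(Ξ1^non) HOLDS for EQUAL weights** `w_j = c`: for EVERY direct product
  region `P` (compact factors of positive volume, not necessarily open) with `μ^log(P) = μ^log(Q)`, `Q` a
  direct product region that is an additive subgroup, some hull `H ⊆ φ(P)` has `μ^log(H) = μ^log(P)`
  (redistribute the total exponent onto one coordinate; core form `xiApprox_nonempty_const`);
* `lt_xi1_nonempty_div_weights_of_isOpen` — **(Ξ1^non) HOLDS for the printed normalized weights**
  `w_j = c/N_j` of Rmk. 3.1.1 (ii) (p. 94: `1/([K_v:(F_mod)_v]·Σ_w [(F_mod)_w:ℚ_{v_ℚ}])`) on direct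
  product regions with compact OPEN factors: each `μ(P_j)` is then forced to be a power of `p` (unique
  factorisation, `eq_prime_pow_of_sum_log_div`), and the hull is chosen coordinatewise
  (`xiApprox_nonempty_of_int_exponents`, valid for ANY weights once the exponents are integral).
CAVEAT recorded, not asserted here: for UNEQUAL weights and a NON-open compact factor the clause can
fail in this model (weights `(c/2, c/3)`, residue fields `𝔽_2`, `μ(P_1) = 8/9`, `μ(P_2) = 27/32`,
`Q = 2O × ½O`: hulls in `φ(P) = O × O` would need `3n₁ + 2n₂ = 1`, `n ≥ 0`).  Nothing here takes a
side on [IUTchIII] Cor. 3.12; Rmk. 3.9.5 (iv) lies outside the Cor. 3.12 cone of the cell's DAG.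
[cite: Mochizuki2012, IUTchIII Rmk. 3.9.5 (iv) p. 128] [cite: Mochizuki2012, IUTchIII Rmk. 3.1.1 (ii) p. 94]
[cite: MochizukiAbsTopIII2015, Prop. 5.7 (i) p. 137]
-/

noncomputable section

open MeasureTheory MeasureTheory.Measure Set Metric TopologicalSpace Bornology Filter
open scoped ENNReal NNReal Pointwise NormedField Topology
open Literature.NumberTheory.GaloisRepresentations.Ultrametric

namespace Literature.IUT.LogVolume

/-! ### The box model `⊕_j K_j`: subgroup regions, equal weights -/

section Box

variable {J : Type*} [Fintype J] (K : J → Type*) [∀ j, NontriviallyNormedField (K j)]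
  [∀ j, IsUltrametricDist (K j)] [∀ j, ProperSpace (K j)] [∀ j, MeasurableSpace (K j)]
  [∀ j, BorelSpace (K j)]

omit [Fintype J] in
/-- **Factors of a subgroup region.**  If the direct product region `Q = ∏_j Q_j` is (the carrier of)
an additive subgroup of `⊕_j K_j` and every residue field is the prime field `𝔽_p`, then each factor
has `μ^log_{K_j}(Q_j) = k_j·log p` with `k_j ∈ ℤ` (each `Q_j` is a compact additive subgroup of positive
volume, hence open; then `exists_localLogVolume_eq_int_mul_log`).
[cite: Mochizuki2012, IUTchIII Rmk. 3.9.5 (iv) p. 128] -/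
theorem exists_logVolume_factor_eq_int_mul_log {p : ℕ} (hp : p.Prime)
    (hres : ∀ j, residueCard (K j) = p) {B : ∀ j, Set (K j)}
    (hB : IntegralStructure.IsDirectProductRegion (fun j => unitBallStructure (K j)) B)
    (G : AddSubgroup (Π j, K j)) (hG : (G : Set (Π j, K j)) = Set.pi univ B) (j : J) :
    ∃ k : ℤ, (unitBallStructure (K j)).logVolume (B j) = k * Real.log p := by
  classical
  have hne : ∀ i, (B i).Nonempty := fun i => nonempty_of_measure_ne_zero (hB.pos i).ne'
  -- the `j`-th projection of `G` is an additive subgroup with carrier `B j`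
  set Gj : AddSubgroup (K j) := G.map (Pi.evalAddMonoidHom K j) with hGjdef
  have hGj : (Gj : Set (K j)) = B j := by
    rw [hGjdef, AddSubgroup.coe_map, hG]
    exact Set.eval_image_univ_pi (Set.univ_pi_nonempty_iff.mpr hne)
  have hq : (residueCard (K j)).Prime := (hres j).symm ▸ hp
  have hpos : 0 < localVolume (K j) Gj := by rw [hGj]; exact hB.pos j
  have hcpt : IsCompact (Gj : Set (K j)) := by rw [hGj]; exact hB.isCompact j
  obtain ⟨k, hk⟩ := exists_localLogVolume_eq_int_mul_log_of_pos (K j) hq Gj hcpt hpos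
  refine ⟨k, ?_⟩
  rw [hGj, hres j] at hk
  exact hk

/-- With weight `0` on every factor the model's weighted log-volume vanishes identically.
[cite: Mochizuki2012, IUTchIII Rmk. 3.1.1 (ii) p. 94] -/
theorem boxLogVolume_zero_weight {w : J → ℝ} (hw : ∀ j, w j = 0) (S : Set (Π j, K j)) :
    boxLogVolume K w S = 0 := by
  simp [boxLogVolume, IntegralStructure.weightedLogVolume_eq_sum, hw]

/-- **(Ξ1^non) for EQUAL weights, core form.**  Residue fields all `= 𝔽_p`; `P = ∏ A_j` and `Q = ∏ B_j`
direct product regions (compact factors of positive volume — NOT assumed open), `Q` an additive subgroup,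
`μ^log(P) = μ^log(Q)` for the weighted log-volume with a constant weight `c`.  Then `Ξ(P) ≠ ∅`: writing
`φ(P) = λ·O_L` with `‖λ_j‖ = ‖ϖ_j‖^{a_j}` and `μ^log(Q_j) = k_j·log p`, one has `Σ_j a_j ≤ T := −Σ_j k_j`
(because `μ(A_j) ≤ μ(λ_j·O_{K_j}) = p^{−a_j}`), and the hull `∏_j ϖ_j^{n_j}·O_{K_j}` with `n = a` except
`n_{j₀} = T − Σ_{j ≠ j₀} a_j` lies in `φ(P)` and has `μ^log = −c·T·log p = μ^log(P)`.
[cite: Mochizuki2012, IUTchIII Rmk. 3.9.5 (iv) p. 128] -/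
theorem xiApprox_nonempty_const (c : ℝ) {p : ℕ} (hp : p.Prime) (hres : ∀ j, residueCard (K j) = p)
    {A B : ∀ j, Set (K j)}
    (hA : IntegralStructure.IsDirectProductRegion (fun j => unitBallStructure (K j)) A)
    (hB : IntegralStructure.IsDirectProductRegion (fun j => unitBallStructure (K j)) B)
    (G : AddSubgroup (Π j, K j)) (hG : (G : Set (Π j, K j)) = Set.pi univ B)
    (hvol : boxLogVolume K (fun _ => c) (Set.pi univ A) = boxLogVolume K (fun _ => c) (Set.pi univ B)) :
    (LogThetaLattice.XiApprox (hullSets K) (holomorphicHull K) (boxLogVolume K (fun _ => c))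
      (Set.pi univ A)).Nonempty := by
  classical
  obtain ⟨cA, hcA, hφ⟩ := holomorphicHull_pi_eq_hullSet K hA
  have hneA : ∀ j, (A j).Nonempty := fun j => nonempty_of_measure_ne_zero (hA.pos j).ne'
  have hneB : ∀ j, (B j).Nonempty := fun j => nonempty_of_measure_ne_zero (hB.pos j).ne'
  have hHul : hullSet K cA ∈ hullSets K := ⟨cA, fun j => (hcA j).2.1, rfl⟩
  -- the trivial candidate `φ(P)` works whenever its log-volume is that of `P`
  have htriv : boxLogVolume K (fun _ => c) (hullSet K cA) = boxLogVolume K (fun _ => c) (Set.pi univ A) →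
      (LogThetaLattice.XiApprox (hullSets K) (holomorphicHull K) (boxLogVolume K (fun _ => c))
        (Set.pi univ A)).Nonempty := fun h =>
    ⟨hullSet K cA, hHul, by rw [hφ], h⟩
  by_cases hc : c = 0
  · subst hc
    exact htriv (by rw [boxLogVolume_zero_weight K (fun _ => rfl),
      boxLogVolume_zero_weight K (fun _ => rfl)])
  rcases isEmpty_or_nonempty J with hJ | ⟨⟨j₀⟩⟩
  · apply htriv
    simp [boxLogVolume, IntegralStructure.weightedLogVolume_eq_sum]
  -- uniformizers, exponents of the radii of `φ(P)`
  have hunif : ∀ j, ∃ ϖ : (K j)ˣ, IsUniformizer ϖ := fun j => exists_isUniformizer (F := K j)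
  choose ϖ hϖ using hunif
  set cU : Π j, (K j)ˣ := fun j => Units.mk0 (cA j) (hcA j).2.1 with hcUdef
  set a : J → ℤ := fun j => (hϖ j).ordFun (cU j) with hadef
  have ha : ∀ j, ‖(cU j : K j)‖ = ‖(ϖ j : K j)‖ ^ a j := fun j => (hϖ j).norm_eq_zpow_ordFun (cU j)
  have ha' : ∀ j, ‖cA j‖ = ‖(ϖ j : K j)‖ ^ a j := ha
  have hlogp : 0 < Real.log p := Real.log_pos (by exact_mod_cast hp.one_lt)
  -- (i) the factor log-volumes of `P` are bounded by those of `φ(P)`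
  set v : J → ℝ := fun j => (unitBallStructure (K j)).logVolume (A j) with hvdef
  have hv_le : ∀ j, v j ≤ -(a j * Real.log p) := by
    intro j
    have hsub : A j ⊆ closedBall (0 : K j) ‖(cU j : K j)‖ := fun x hx =>
      mem_closedBall_zero_iff.mpr ((hcA j).2.2 x hx)
    have hball := localLogVolume_closedBall_norm_of_eq_zpow (K j) (hϖ j) (ha j)
    rw [hres j] at hball
    have hfin : (unitBallStructure (K j)).haar (closedBall (0 : K j) ‖(cU j : K j)‖) < ∞ :=
      (unitBallStructure (K j)).haar_lt_top_of_isCompact (isCompact_closedBall _ _)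
    have hmono := (unitBallStructure (K j)).logVolume_mono (hA.pos j) hfin hsub
    rw [show (unitBallStructure (K j)).logVolume (closedBall (0 : K j) ‖(cU j : K j)‖) =
      localLogVolume (K j) (closedBall (0 : K j) ‖(cU j : K j)‖) from rfl, hball] at hmono
    exact hmono
  -- (ii) the factor log-volumes of `Q` are integer multiples of `log p`
  have hk : ∀ j, ∃ k : ℤ, (unitBallStructure (K j)).logVolume (B j) = k * Real.log p :=
    fun j => exists_logVolume_factor_eq_int_mul_log K hp hres hB G hG j
  choose k hk using hk
  -- (iii) the two weighted log-volumes
  have hPvol : boxLogVolume K (fun _ => c) (Set.pi univ A) = c * ∑ j, v j := by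
    rw [boxLogVolume_pi K _ hneA, IntegralStructure.weightedLogVolume_eq_sum, ← Finset.mul_sum]
  have hQvol : boxLogVolume K (fun _ => c) (Set.pi univ B) = c * ((∑ j, k j : ℤ) : ℝ) * Real.log p := by
    rw [boxLogVolume_pi K _ hneB, IntegralStructure.weightedLogVolume_eq_sum, Int.cast_sum,
      Finset.mul_sum, Finset.sum_mul]
    exact Finset.sum_congr rfl fun j _ => by rw [hk j]; ring
  set T : ℤ := -∑ j, k j with hTdef
  have hsumv : ∑ j, v j = -(T * Real.log p) := by
    have h := hvol
    rw [hPvol, hQvol, mul_assoc] at h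
    have h' := mul_left_cancel₀ hc h
    rw [h', hTdef]
    push_cast
    ring
  -- `Σ a_j ≤ T`
  have haT : ∑ j, a j ≤ T := by
    have h1 : ∑ j, v j ≤ ∑ j, -(a j * Real.log p) := Finset.sum_le_sum fun j _ => hv_le j
    rw [hsumv] at h1
    have h2 : ((∑ j, a j : ℤ) : ℝ) * Real.log p ≤ T * Real.log p := by
      rw [Int.cast_sum, Finset.sum_mul]
      have : ∑ j, -(a j * Real.log p) = -∑ j, (a j : ℝ) * Real.log p := by
        rw [Finset.sum_neg_distrib]
      linarith
    exact_mod_cast le_of_mul_le_mul_right h2 hlogp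
  -- the exponents of the witness hull
  set n : J → ℤ := fun j => a j + if j = j₀ then T - ∑ i, a i else 0 with hndef
  have hn_ge : ∀ j, a j ≤ n j := by
    intro j
    simp only [hndef]
    split_ifs
    · linarith
    · simp
  have hn_sum : ∑ j, n j = T := by
    simp only [hndef, Finset.sum_add_distrib, Finset.sum_ite_eq', Finset.mem_univ, if_true]
    ring
  set d : Π j, (K j)ˣ := fun j => ϖ j ^ n j with hddef
  refine ⟨hullSet K (fun j => (d j : K j)), ⟨_, fun j => (d j).ne_zero, rfl⟩, ?_, ?_⟩
  · -- `H ⊆ φ(P)`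
    rw [hφ, hullSet_subset_iff]
    intro j
    rw [ha' j, hddef]
    dsimp only
    rw [Units.val_zpow_eq_zpow_val, norm_zpow]
    exact zpow_le_zpow_right_of_le_one₀ (norm_units_pos (ϖ j)) (hϖ j).norm_lt_one.le (hn_ge j)
  · -- `μ^log(H) = μ^log(P)`
    rw [boxLogVolume_hullSet, hPvol, hsumv]
    have hterm : ∀ j, c * mulLogVolume (K j) (d j) = -(c * Real.log p) * n j := by
      intro j
      rw [hddef]
      dsimp only
      rw [mulLogVolume_uniformizer_zpow (K j) (hϖ j) (n j), hres j]
      ring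
    rw [Finset.sum_congr rfl fun j _ => hterm j, ← Finset.mul_sum, ← Int.cast_sum, hn_sum]
    ring

/-- **(Ξ1^non) of [IUTchIII] Rmk. 3.9.5 (iv) HOLDS in the model for EQUAL weights** — the named
statement `LogThetaLattice.Xi1_nonempty` of the layer-L6 statement file, instantiated with
`Hul := hullSets K`, `φ := holomorphicHull K`, `μ^log := boxLogVolume K (fun _ => c)` (any constant
weight `c`), `ResidueDegreesOne := ∃ p prime, ∀ j, #(O_{K_j}/m_{K_j}) = p`, `IsArchimedean := False`
(this is the nonarchimedean model), `IsSubmoduleRegion Q := Q` is (the carrier of) an additive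
subgroup (weaker than the printed `ℤ_p`-submodule condition), `Preg := directProductRegions K` (ALL
direct product regions). [cite: Mochizuki2012, IUTchIII Rmk. 3.9.5 (iv) p. 128] -/
theorem lt_xi1_nonempty_const (c : ℝ) :
    LogThetaLattice.Xi1_nonempty (hullSets K) (holomorphicHull K) (boxLogVolume K (fun _ => c))
      (∃ p : ℕ, p.Prime ∧ ∀ j, residueCard (K j) = p) False
      (fun Q => ∃ G : AddSubgroup (Π j, K j), (G : Set (Π j, K j)) = Q)
      (directProductRegions K) := by
  rintro P ⟨A, rfl, hA⟩ (⟨⟨p, hp, hres⟩, Q, ⟨B, rfl, hB⟩, ⟨G, hG⟩, hvol⟩ | h)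
  · exact xiApprox_nonempty_const K c hp hres hA hB G hG hvol
  · exact h.elim

/-! ### The box model: integral exponents, and the printed weights `c/N_j` on compact open regions -/

/-- **Coordinatewise witness.**  If every factor of the direct product region `P = ∏ A_j` has a
log-volume of the form `μ^log(A_j) = −t_j·log p` with `t_j ∈ ℤ` (residue fields all `= 𝔽_p`), then
`Ξ(P) ≠ ∅` for EVERY weight vector `w`: the hull `∏_j ϖ_j^{t_j}·O_{K_j}` lies in `φ(P)` (as
`μ(A_j) ≤ μ(φ(P)_j)` gives `t_j ≥ a_j`) and has the same weighted log-volume as `P`, factor by factor.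
[cite: Mochizuki2012, IUTchIII Rmk. 3.9.5 (iv) p. 128] -/
theorem xiApprox_nonempty_of_int_exponents (w : J → ℝ) {p : ℕ} (hp : p.Prime)
    (hres : ∀ j, residueCard (K j) = p) {A : ∀ j, Set (K j)}
    (hA : IntegralStructure.IsDirectProductRegion (fun j => unitBallStructure (K j)) A)
    (ht : ∀ j, ∃ t : ℤ, (unitBallStructure (K j)).logVolume (A j) = -(t * Real.log p)) :
    (LogThetaLattice.XiApprox (hullSets K) (holomorphicHull K) (boxLogVolume K w)
      (Set.pi univ A)).Nonempty := by
  classical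
  obtain ⟨cA, hcA, hφ⟩ := holomorphicHull_pi_eq_hullSet K hA
  have hneA : ∀ j, (A j).Nonempty := fun j => nonempty_of_measure_ne_zero (hA.pos j).ne'
  have hunif : ∀ j, ∃ ϖ : (K j)ˣ, IsUniformizer ϖ := fun j => exists_isUniformizer (F := K j)
  choose ϖ hϖ using hunif
  choose t ht using ht
  set cU : Π j, (K j)ˣ := fun j => Units.mk0 (cA j) (hcA j).2.1 with hcUdef
  set a : J → ℤ := fun j => (hϖ j).ordFun (cU j) with hadef
  have ha : ∀ j, ‖(cU j : K j)‖ = ‖(ϖ j : K j)‖ ^ a j := fun j => (hϖ j).norm_eq_zpow_ordFun (cU j)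
  have ha' : ∀ j, ‖cA j‖ = ‖(ϖ j : K j)‖ ^ a j := ha
  have hlogp : 0 < Real.log p := Real.log_pos (by exact_mod_cast hp.one_lt)
  -- `a_j ≤ t_j` from `μ(A_j) ≤ μ(φ(P)_j)`
  have hat : ∀ j, a j ≤ t j := by
    intro j
    have hsub : A j ⊆ closedBall (0 : K j) ‖(cU j : K j)‖ := fun x hx =>
      mem_closedBall_zero_iff.mpr ((hcA j).2.2 x hx)
    have hball := localLogVolume_closedBall_norm_of_eq_zpow (K j) (hϖ j) (ha j)
    rw [hres j] at hball
    have hfin : (unitBallStructure (K j)).haar (closedBall (0 : K j) ‖(cU j : K j)‖) < ∞ :=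
      (unitBallStructure (K j)).haar_lt_top_of_isCompact (isCompact_closedBall _ _)
    have hmono := (unitBallStructure (K j)).logVolume_mono (hA.pos j) hfin hsub
    rw [show (unitBallStructure (K j)).logVolume (closedBall (0 : K j) ‖(cU j : K j)‖) =
      localLogVolume (K j) (closedBall (0 : K j) ‖(cU j : K j)‖) from rfl, hball, ht j] at hmono
    have : (a j : ℝ) * Real.log p ≤ t j * Real.log p := by linarith
    exact_mod_cast le_of_mul_le_mul_right this hlogp
  set d : Π j, (K j)ˣ := fun j => ϖ j ^ t j with hddef
  refine ⟨hullSet K (fun j => (d j : K j)), ⟨_, fun j => (d j).ne_zero, rfl⟩, ?_, ?_⟩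
  · rw [hφ, hullSet_subset_iff]
    intro j
    rw [ha' j, hddef]
    dsimp only
    rw [Units.val_zpow_eq_zpow_val, norm_zpow]
    exact zpow_le_zpow_right_of_le_one₀ (norm_units_pos (ϖ j)) (hϖ j).norm_lt_one.le (hat j)
  · rw [boxLogVolume_hullSet, boxLogVolume_pi K _ hneA, IntegralStructure.weightedLogVolume_eq_sum]
    refine Finset.sum_congr rfl fun j _ => ?_
    rw [hddef]
    dsimp only
    rw [mulLogVolume_uniformizer_zpow (K j) (hϖ j) (t j), hres j, ht j]

/-- **(Ξ1^non) for the printed normalized weights on compact OPEN regions, core form.**  Weights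
`w_j = c/N_j` (`N_j ≥ 1` integers — the shape `1/([K_v:(F_mod)_v]·Σ_w[(F_mod)_w:ℚ_{v_ℚ}])` of
[IUTchIII] Rmk. 3.1.1 (ii)); residue fields all `= 𝔽_p`; `P = ∏ A_j` with `A_j` compact OPEN of
positive volume; `Q = ∏ B_j` a direct product region that is an additive subgroup; `μ^log(P) =
μ^log(Q)`.  Then `Ξ(P) ≠ ∅`: `μ(A_j) = m_j·p^{k_j}` (`exists_localLogVolume_eq_log_nat_add`),
`μ(B_j) = p^{k'_j}`, and the single relation `Σ_j (log m_j)/N_j ∈ (Σ_j ℤ/N_j)·log p` forces every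
`m_j` to be a power of `p` (`eq_prime_pow_of_sum_log_div`), so the coordinatewise witness applies.
[cite: Mochizuki2012, IUTchIII Rmk. 3.9.5 (iv) p. 128] [cite: Mochizuki2012, IUTchIII Rmk. 3.1.1 (ii) p. 94] -/
theorem xiApprox_nonempty_div_weights_of_isOpen (c : ℝ) (N : J → ℕ) (hN : ∀ j, 0 < N j) {p : ℕ}
    (hp : p.Prime) (hres : ∀ j, residueCard (K j) = p) {A B : ∀ j, Set (K j)}
    (hA : IntegralStructure.IsDirectProductRegion (fun j => unitBallStructure (K j)) A)
    (hAo : ∀ j, IsOpen (A j))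
    (hB : IntegralStructure.IsDirectProductRegion (fun j => unitBallStructure (K j)) B)
    (G : AddSubgroup (Π j, K j)) (hG : (G : Set (Π j, K j)) = Set.pi univ B)
    (hvol : boxLogVolume K (fun j => c / N j) (Set.pi univ A) =
      boxLogVolume K (fun j => c / N j) (Set.pi univ B)) :
    (LogThetaLattice.XiApprox (hullSets K) (holomorphicHull K) (boxLogVolume K (fun j => c / N j))
      (Set.pi univ A)).Nonempty := by
  classical
  have hneA : ∀ j, (A j).Nonempty := fun j => nonempty_of_measure_ne_zero (hA.pos j).ne'
  have hneB : ∀ j, (B j).Nonempty := fun j => nonempty_of_measure_ne_zero (hB.pos j).ne'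
  by_cases hc : c = 0
  · subst hc
    obtain ⟨cA, hcA, hφ⟩ := holomorphicHull_pi_eq_hullSet K hA
    refine ⟨hullSet K cA, ⟨cA, fun j => (hcA j).2.1, rfl⟩, by rw [hφ], ?_⟩
    rw [boxLogVolume_zero_weight K (fun j => by simp), boxLogVolume_zero_weight K (fun j => by simp)]
  -- factor volumes: `μ^log(A_j) = log m_j + k_j log p`, `μ^log(B_j) = k'_j log p`
  have hm : ∀ j, ∃ (m : ℕ) (k : ℤ), 0 < m ∧
      (unitBallStructure (K j)).logVolume (A j) = Real.log m + k * Real.log p := by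
    intro j
    have hq : (residueCard (K j)).Prime := (hres j).symm ▸ hp
    obtain ⟨m, k, hm, h⟩ :=
      exists_localLogVolume_eq_log_nat_add (K j) hq (hA.isCompact j) (hAo j) (hneA j)
    rw [hres j] at h
    exact ⟨m, k, hm, h⟩
  choose m k hm hmk using hm
  have hk' : ∀ j, ∃ k' : ℤ, (unitBallStructure (K j)).logVolume (B j) = k' * Real.log p :=
    fun j => exists_logVolume_factor_eq_int_mul_log K hp hres hB G hG j
  choose k' hk' using hk'
  -- the relation between the weighted sums, with `c` cancelled
  have hPvol : boxLogVolume K (fun j => c / N j) (Set.pi univ A) =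
      c * ∑ j, (Real.log (m j) + k j * Real.log p) / N j := by
    rw [boxLogVolume_pi K _ hneA, IntegralStructure.weightedLogVolume_eq_sum, Finset.mul_sum]
    exact Finset.sum_congr rfl fun j _ => by rw [hmk j]; ring
  have hQvol : boxLogVolume K (fun j => c / N j) (Set.pi univ B) =
      c * ∑ j, ((k' j : ℝ) * Real.log p) / N j := by
    rw [boxLogVolume_pi K _ hneB, IntegralStructure.weightedLogVolume_eq_sum, Finset.mul_sum]
    exact Finset.sum_congr rfl fun j _ => by rw [hk' j]; ring
  have hrel : ∑ j, Real.log (m j) / N j = (∑ j, ((k' j - k j : ℤ) : ℝ) / N j) * Real.log p := by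
    have h := hvol
    rw [hPvol, hQvol] at h
    have h' := mul_left_cancel₀ hc h
    have hsplit : ∑ j, (Real.log (m j) + k j * Real.log p) / N j =
        ∑ j, Real.log (m j) / N j + ∑ j, ((k j : ℝ) * Real.log p) / N j := by
      rw [← Finset.sum_add_distrib]
      exact Finset.sum_congr rfl fun j _ => by ring
    rw [hsplit] at h'
    rw [Finset.sum_mul]
    have : ∀ j, ((k' j - k j : ℤ) : ℝ) / N j * Real.log p =
        ((k' j : ℝ) * Real.log p) / N j - ((k j : ℝ) * Real.log p) / N j := fun j => by
      push_cast
      ring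
    rw [Finset.sum_congr rfl fun j _ => this j, Finset.sum_sub_distrib]
    linarith
  -- unique factorisation: every `m_j` is a power of `p`
  have hpow := eq_prime_pow_of_sum_log_div hp N hN m hm (fun j => k' j - k j) hrel
  -- hence integral exponents, and the coordinatewise witness
  refine xiApprox_nonempty_of_int_exponents K (fun j => c / N j) hp hres hA fun j => ?_
  obtain ⟨b, hb⟩ := hpow j
  refine ⟨-((b : ℤ) + k j), ?_⟩
  rw [hmk j, hb]
  push_cast
  rw [Real.log_pow]
  ring

/-- **(Ξ1^non) of [IUTchIII] Rmk. 3.9.5 (iv) HOLDS in the model for the PRINTED normalized weights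
`c/N_j` on compact open regions** — the named statement `LogThetaLattice.Xi1_nonempty`, instantiated
as in `lt_xi1_nonempty_const` but with the weights `w_j = c/N_j` of Rmk. 3.1.1 (ii) and with
`Preg :=` the direct product regions with compact OPEN factors of positive volume (the regions that
actually occur in [IUTchIII] §3 — log-shells, their `p^n`-multiples, hulls — are of this kind).
[cite: Mochizuki2012, IUTchIII Rmk. 3.9.5 (iv) p. 128] [cite: Mochizuki2012, IUTchIII Rmk. 3.1.1 (ii) p. 94] -/
theorem lt_xi1_nonempty_div_weights_of_isOpen (c : ℝ) (N : J → ℕ) (hN : ∀ j, 0 < N j) :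
    LogThetaLattice.Xi1_nonempty (hullSets K) (holomorphicHull K) (boxLogVolume K (fun j => c / N j))
      (∃ p : ℕ, p.Prime ∧ ∀ j, residueCard (K j) = p) False
      (fun Q => ∃ G : AddSubgroup (Π j, K j), (G : Set (Π j, K j)) = Q)
      {S | ∃ A : ∀ j, Set (K j), S = Set.pi univ A ∧
        IntegralStructure.IsDirectProductRegion (fun j => unitBallStructure (K j)) A ∧
        ∀ j, IsOpen (A j)} := by
  rintro P ⟨A, rfl, hA, hAo⟩ (⟨⟨p, hp, hres⟩, Q, ⟨B, rfl, hB, -⟩, ⟨G, hG⟩, hvol⟩ | h)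
  · exact xiApprox_nonempty_div_weights_of_isOpen K c N hN hp hres hA hAo hB G hG hvol
  · exact h.elim

end Box

end Literature.IUT.LogVolume

end
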